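import Mathlib
import HarnessLib

/-!
# Defect identities of the two-row `SU(3)` reconstruction `[u; v; conj(u × v)]`: the third row is EXACTLY orthogonal to the first two for any input, and `det = |u|²|v|² − |⟨u,v⟩|²` — the orthogonality defect enters at second order

HONEST FRAMING: exact (Metropolis-corrected) sampling algorithms for lattice gauge theory;
figures of merit are autocorrelation/cost numbers at stated couplings and volumes; no
continuum-physics claim.

Venture `LatticeQCDFlow` (cell pub-lqcd), sub-topic `Scoring`; FANOUT row 21 (`su3-base`: the 4D
`SU(3)` baselines).  NEW WORK of the cell (placement rule), Mathlib-only (the cross product `⨯₃` and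
`cross_dot_cross`, `dot_self_cross`, `dot_cross_self`, `triple_product_eq_det` of
`Mathlib.LinearAlgebra.CrossProduct`), elementary; no definition is introduced; nothing is cited as a
fact; no number of ours.  Companion of row 21 GEN-8's `Scoring/SU3TwoRowReconstruction` (exact
orthonormal input ⟹ the reconstruction is in `SU(3)`); NAMED ONLY: the 12-number link formats of
GPU codes (Clark et al. 2010), whose inputs are orthonormal only up to rounding.

For ARBITRARY rows `u, v ∈ ℂ³` (no orthonormality assumed) and `w = conj(u × v)`, the Gram matrix
`M M†` of `M = [u; v; w]` has the entries

* `(M M†)₀₂ = (M M†)₁₂ = (M M†)₂₀ = (M M†)₂₁ = 0` EXACTLY (`u·(u×v) = v·(u×v) = 0` identically),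
* `(M M†)₂₂ = (u·ū)(v·v̄) − (u·v̄)(v·ū) = |u|²|v|² − |⟨u,v⟩|²` (Lagrange), and `det M` equals the
  same real quantity,

so the only defects of the reconstructed link are those of the INPUT rows (`|u|² − 1`, `|v|² − 1`,
`⟨u, v⟩`) and, in the third row and the determinant, the combination `|u|²|v|² − |⟨u,v⟩|² − 1`,
which for unit rows is `−|⟨u,v⟩|²`: second order in the orthogonality defect.

## What is proved (`u v : Fin 3 → ℂ`, `w = star (u ⨯₃ v)`, Hermitian pairing `a ⬝ᵥ star b`)

* `reconstruct_row_two_orth_zero`, `reconstruct_row_two_orth_one` — `u ⬝ w̄ = 0`, `v ⬝ w̄ = 0`;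
  `reconstruct_orth_two_zero`, `reconstruct_orth_two_one` — `w ⬝ ū = 0`, `w ⬝ v̄ = 0`;
* **`reconstruct_row_two_normSq`** — `w ⬝ w̄ = (u⬝ū)(v⬝v̄) − (u⬝v̄)(v⬝ū)`;
* **`reconstruct_det`** — `det [u; v; w] = (u⬝ū)(v⬝v̄) − (u⬝v̄)(v⬝ū)`;
* `reconstruct_det_of_unit_rows` — if `u⬝ū = v⬝v̄ = 1` then `det = 1 − (u⬝v̄)(v⬝ū)`
  (`= 1 − |⟨u,v⟩|²`: `reconstruct_det_re_of_unit_rows`), and `reconstruct_row_two_normSq_of_unit_rows`.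

NOT CLAIMED: any floating-point model; the closest-`SU(3)` projection of a defective input.
-/

namespace Summit.Ventures.LatticeQCDFlow.Scoring

open Matrix

section Defects

variable (u v : Fin 3 → ℂ)

/-- `u ⬝ conj(w) = 0` for `w = conj(u × v)`: the first row is exactly Hermitian-orthogonal to the
reconstructed third row, for ANY `u, v`. -/
theorem reconstruct_row_two_orth_zero : u ⬝ᵥ star (star (u ⨯₃ v)) = 0 := by
  rw [star_star]
  exact dot_self_cross u v

/-- `v ⬝ conj(w) = 0`. -/
theorem reconstruct_row_two_orth_one : v ⬝ᵥ star (star (u ⨯₃ v)) = 0 := by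
  rw [star_star]
  exact dot_cross_self u v

/-- `w ⬝ conj(u) = 0`. -/
theorem reconstruct_orth_two_zero : star (u ⨯₃ v) ⬝ᵥ star u = 0 := by
  rw [star_dotProduct_star, dot_self_cross, star_zero]

/-- `w ⬝ conj(v) = 0`. -/
theorem reconstruct_orth_two_one : star (u ⨯₃ v) ⬝ᵥ star v = 0 := by
  rw [star_dotProduct_star, dot_cross_self, star_zero]

/-- **Lagrange's identity for the reconstructed row**:
`w ⬝ conj(w) = (u⬝ū)(v⬝v̄) − (u⬝v̄)(v⬝ū)` (`= |u|²|v|² − |⟨u,v⟩|²`). -/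
theorem reconstruct_row_two_normSq :
    star (u ⨯₃ v) ⬝ᵥ star (star (u ⨯₃ v)) =
      (u ⬝ᵥ star u) * (v ⬝ᵥ star v) - (u ⬝ᵥ star v) * (v ⬝ᵥ star u) := by
  have star_cross_eq : star (u ⨯₃ v) = star u ⨯₃ star v := by
    rw [cross_apply, cross_apply]
    funext j
    fin_cases j <;> simp [Pi.star_apply]
  rw [star_star, dotProduct_comm, star_cross_eq, cross_dot_cross]

/-- **The determinant of the reconstruction** `[u; v; conj(u × v)]` is
`(u⬝ū)(v⬝v̄) − (u⬝v̄)(v⬝ū)`, for ANY `u, v`. -/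
theorem reconstruct_det :
    Matrix.det (![u, v, star (u ⨯₃ v)] : Matrix (Fin 3) (Fin 3) ℂ) =
      (u ⬝ᵥ star u) * (v ⬝ᵥ star v) - (u ⬝ᵥ star v) * (v ⬝ᵥ star u) := by
  have star_cross_eq : star (u ⨯₃ v) = star u ⨯₃ star v := by
    rw [cross_apply, cross_apply]
    funext j
    fin_cases j <;> simp [Pi.star_apply]
  rw [← triple_product_eq_det, triple_product_permutation u v, triple_product_permutation v _ u,
    star_cross_eq, cross_dot_cross, dotProduct_comm (star u) u, dotProduct_comm (star v) v,
    dotProduct_comm (star u) v, dotProduct_comm (star v) u]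
  ring

/-- With exactly unit rows the determinant defect is second order in the orthogonality defect:
`det = 1 − (u⬝v̄)(v⬝ū)`. -/
theorem reconstruct_det_of_unit_rows (hu : u ⬝ᵥ star u = 1) (hv : v ⬝ᵥ star v = 1) :
    Matrix.det (![u, v, star (u ⨯₃ v)] : Matrix (Fin 3) (Fin 3) ℂ) = 1 - (u ⬝ᵥ star v) * (v ⬝ᵥ star u) := by
  rw [reconstruct_det, hu, hv, one_mul]

/-- The defect `(u⬝v̄)(v⬝ū)` is the squared modulus `|⟨u,v⟩|²` (a non-negative real): with unit
rows, `Re det = 1 − |u⬝v̄|²` and `Im det = 0`. -/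
theorem reconstruct_det_re_of_unit_rows (hu : u ⬝ᵥ star u = 1) (hv : v ⬝ᵥ star v = 1) :
    (Matrix.det (![u, v, star (u ⨯₃ v)] : Matrix (Fin 3) (Fin 3) ℂ)).re = 1 - ‖u ⬝ᵥ star v‖ ^ 2 ∧
      (Matrix.det (![u, v, star (u ⨯₃ v)] : Matrix (Fin 3) (Fin 3) ℂ)).im = 0 := by
  rw [reconstruct_det_of_unit_rows u v hu hv]
  have hvu : v ⬝ᵥ star u = (starRingEnd ℂ) (u ⬝ᵥ star v) := by
    rw [dotProduct_star, Complex.star_def]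
  rw [hvu, Complex.mul_conj, Complex.normSq_eq_norm_sq, ← Complex.ofReal_one, ← Complex.ofReal_sub,
    Complex.ofReal_re, Complex.ofReal_im]
  exact ⟨rfl, rfl⟩

/-- With unit rows the reconstructed third row has squared norm `1 − |⟨u,v⟩|²`. -/
theorem reconstruct_row_two_normSq_of_unit_rows (hu : u ⬝ᵥ star u = 1) (hv : v ⬝ᵥ star v = 1) :
    star (u ⨯₃ v) ⬝ᵥ star (star (u ⨯₃ v)) = 1 - (u ⬝ᵥ star v) * (v ⬝ᵥ star u) := by
  rw [reconstruct_row_two_normSq, hu, hv, one_mul]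

end Defects

end Summit.Ventures.LatticeQCDFlow.Scoring
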